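import Mathlib
import Summits.KontsevichZagierPeriods.KontsevichZagierPeriods.Theorems.SoloInformedKummerZetaKernel
import HarnessLib
import HarnessLib.Audit

/-!
# Kummer family V: the circular reciprocity law for the third kind, I — the certificate (s41)

THEOREM XXVIII(b) of the residency paper (§6quattuordecies): for a real algebraic squared modulus
`0 < m < 1` and a pole parameter `m < n < 1` (the CIRCULAR band of the Kummer family) the complete
elliptic integral of the third kind `Π(n|m) = ∫₀¹ dx/((1−nx²)√((1−x²)(1−mx²)))` satisfies, in the
formal period ring `P` of the Kontsevich–Zagier calculus,

  `2·⟦[pt, c(s)]⟧·(⟦Π_n⟧ − ⟦K⟧) + 2·(⟦E⟧·⟦F♭_s⟧ + ⟦K⟧·⟦E♭_s⟧ − ⟦K⟧·⟦F♭_s⟧) = ⟦[0 ≤ y ≤ 2√(1−x²)], 1⟧ = "π"`,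

`n = 1 − (1−m)s²`, `c(s) = (1−m) s √(1−s²)/√(1−(1−m)s²) = δ₂⁻¹`, where `F♭_s = [(0,s), κ']`,
`E♭_s = [(0,s), e']` are the incomplete integrals of the first/second kind of the COMPLEMENTARY
modulus `1 − m` at amplitude `sin θ = s` (in values: `Π(n|m) = K + (π/2)δ₂(1 − Λ₀(θ|m))`, Heuman's
Lambda function, Abramowitz–Stegun 17.7.14 with 17.4.39).  This file is the pointwise CERTIFICATE
in the amplitude coordinates `(x, s)` found in s41, regular up to the cusp `s = 1` (`n = m`, where
the law degenerates to Legendre's relation): with `κ(x) = ((1−x²)(1−mx²))^{-1/2}`,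
`κ'(s) = ((1−s²)(1−(1−m)s²))^{-1/2}`, `W, W'` the radicands, `D = 1 − (1 − (1−m)s²)x²`, the
DEFORMATION POTENTIAL and the KILL POTENTIAL

  `Ψ(x,s) = (1−m)x²κ(x) · (sW'(s)/D) · κ'(s)`,   `Ξ(x,s) = (xW(x)/D) · κ(x) · (1−(1−m)s²)κ'(s)`

have `∂_s Ψ = R κ(x)κ'(s)`, `∂_x Ξ = S κ(x)κ'(s)` with `R, S` RATIONAL and

  `S − R = (1 − (1−m)s²) − m x²`,  i.e.  `∂_x Ξ = ∂_s Ψ + (e − κ)(x)κ'(s) + κ(x)e'(s)`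

(`e = (1−mx²)κ`, `e' = (1−(1−m)s²)κ'`): the in-calculus Gauss–Manin derivative of `ξ_n` along the
circular band.  Since `Ψ(x,1) = 0`, `Ξ(0,s) = Ξ(1,s) = 0` and `−Ψ(x,s) = c(s)·(κ − κ/(1−nx²))(x)`,
one Newton–Leibniz move in `s` over the closed band `[s,1]`, one kill along the fibres, three
Fubini products and Legendre's relation (THEOREM XVII) give the law (files II–V:
`SoloInformedKummerHeumanProfile`, `…Band`, `…Moves`, `SoloInformedKummerHeuman`).  This file:
the four definitions, positivity of `D`, the rational identity, the certificate, and the two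
derivative computations.

References: M. Abramowitz, I. Stegun, *Handbook of Mathematical Functions*, §17.7 (17.7.14);
M. Kontsevich, D. Zagier, *Periods* (2001), §1.2; this work (solo-informed s38, s41).
-/

noncomputable section

open MeasureTheory Set Filter
open scoped Classical

namespace Summit.KontsevichZagierPeriods.KontsevichZagierPeriods.Theorems

/-- The rational factor `R(x,s)` of `∂_s Ψ = R κ(x) κ'(s)`:
`R = (1−m)x²[A'(s)/D − 2(1−m)s²x²W'(s)/D²]`, `A'(s) = 1 − 2(2−m)s² + 3(1−m)s⁴`. [this work] -/
def soloInformedKummerHeumanR (m x s : ℝ) : ℝ :=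
  (1 - m) * x ^ 2 *
    ((1 - 2 * (1 + (1 - m)) * s ^ 2 + 3 * (1 - m) * s ^ 4) / (1 - (1 - (1 - m) * s ^ 2) * x ^ 2) -
      2 * (1 - m) * s ^ 2 * x ^ 2 * ((1 - s ^ 2) * (1 - (1 - m) * s ^ 2)) /
        (1 - (1 - (1 - m) * s ^ 2) * x ^ 2) ^ 2)

/-- The rational factor `S(x,s)` of `∂_x Ξ = S κ(x) κ'(s)`:
`S = n[A(x)/D + 2n x²W(x)/D²]`, `n = 1 − (1−m)s²`, `A(x) = 1 − 2(1+m)x² + 3mx⁴`. [this work] -/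
def soloInformedKummerHeumanS (m x s : ℝ) : ℝ :=
  (1 - (1 - m) * s ^ 2) *
    ((1 - 2 * (1 + m) * x ^ 2 + 3 * m * x ^ 4) / (1 - (1 - (1 - m) * s ^ 2) * x ^ 2) +
      2 * (1 - (1 - m) * s ^ 2) * x ^ 2 * ((1 - x ^ 2) * (1 - m * x ^ 2)) /
        (1 - (1 - (1 - m) * s ^ 2) * x ^ 2) ^ 2)

/-- The deformation potential `Ψ(x,s) = (1−m)x²κ(x) · (sW'(s)/D) · κ'(s)`. [this work] -/
def soloInformedKummerHeumanPsi (m x s : ℝ) : ℝ :=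
  (1 - m) * x ^ 2 * ((√(1 - x ^ 2))⁻¹ * (√(1 - m * x ^ 2))⁻¹) *
    (s * ((1 - s ^ 2) * (1 - (1 - m) * s ^ 2)) / (1 - (1 - (1 - m) * s ^ 2) * x ^ 2)) *
      ((√(1 - s ^ 2))⁻¹ * (√(1 - (1 - m) * s ^ 2))⁻¹)

/-- The kill potential `Ξ(x,s) = (xW(x)/D) · κ(x) · (1−(1−m)s²)κ'(s)`. [this work] -/
def soloInformedKummerHeumanXi (m x s : ℝ) : ℝ :=
  x * ((1 - x ^ 2) * (1 - m * x ^ 2)) / (1 - (1 - (1 - m) * s ^ 2) * x ^ 2) *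
    ((√(1 - x ^ 2))⁻¹ * (√(1 - m * x ^ 2))⁻¹) *
      ((1 - (1 - m) * s ^ 2) * ((√(1 - s ^ 2))⁻¹ * (√(1 - (1 - m) * s ^ 2))⁻¹))

/-! ### Elementary positivity -/

/-- `0 < m < 1 ↔ 0 < 1 − m < 1`. [folklore] -/
theorem soloInformed_kummerHeuman_compl {m : ℝ} (hm : m ∈ Ioo (0:ℝ) 1) : 1 - m ∈ Ioo (0:ℝ) 1 :=
  ⟨by linarith [hm.2], by linarith [hm.1]⟩

/-- `D = 1 − (1−(1−m)s²)x² = (1 − x²) + (1−m)s²x² > 0` for `x² < 1`. [folklore] -/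
theorem soloInformed_kummerHeuman_denom_pos {m x s : ℝ} (hm : m ∈ Ioo (0:ℝ) 1) (hx : x ^ 2 < 1) :
    0 < 1 - (1 - (1 - m) * s ^ 2) * x ^ 2 := by
  have h : 0 ≤ (1 - m) * s ^ 2 * x ^ 2 :=
    mul_nonneg (mul_nonneg (by linarith [hm.2]) (sq_nonneg s)) (sq_nonneg x)
  nlinarith

/-- `D > 0` for `x² ≤ 1` and `s ≠ 0`. [folklore] -/
theorem soloInformed_kummerHeuman_denom_pos' {m x s : ℝ} (hm : m ∈ Ioo (0:ℝ) 1) (hx : x ^ 2 ≤ 1)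
    (hs : s ≠ 0) : 0 < 1 - (1 - (1 - m) * s ^ 2) * x ^ 2 := by
  rcases hx.lt_or_eq with h | h
  · exact soloInformed_kummerHeuman_denom_pos hm h
  · rw [h]
    have : 0 < (1 - m) * s ^ 2 := mul_pos (by linarith [hm.2]) (by positivity)
    nlinarith

/-- Uniform lower bound on a band: `(1−m)s₁² ≤ D ≤ 1` for `x² ≤ 1`, `0 ≤ s₁ ≤ s ≤ 1`. [folklore] -/
theorem soloInformed_kummerHeuman_denom_ge {m x s s₁ : ℝ} (hm : m ∈ Ioo (0:ℝ) 1) (hx : x ^ 2 ≤ 1)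
    (hs₁ : 0 ≤ s₁) (hs : s₁ ≤ s) (hs1 : s ≤ 1) :
    (1 - m) * s₁ ^ 2 ≤ 1 - (1 - (1 - m) * s ^ 2) * x ^ 2 ∧
      1 - (1 - (1 - m) * s ^ 2) * x ^ 2 ≤ 1 := by
  have h1m : 0 < 1 - m := by linarith [hm.2]
  have hss : s₁ ^ 2 ≤ s ^ 2 := pow_le_pow_left₀ hs₁ hs 2
  have hs2 : s ^ 2 ≤ 1 := by nlinarith
  have hms₁ : (1 - m) * s₁ ^ 2 ≤ 1 * s₁ ^ 2 :=
    mul_le_mul_of_nonneg_right (by linarith [hm.1]) (sq_nonneg s₁)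
  have hms : (1 - m) * s ^ 2 ≤ 1 * s ^ 2 :=
    mul_le_mul_of_nonneg_right (by linarith [hm.1]) (sq_nonneg s)
  have hA : 0 ≤ (1 - m) * x ^ 2 * (s ^ 2 - s₁ ^ 2) :=
    mul_nonneg (mul_nonneg h1m.le (sq_nonneg x)) (by linarith)
  have hB : 0 ≤ (1 - x ^ 2) * (1 - (1 - m) * s₁ ^ 2) :=
    mul_nonneg (by linarith) (by linarith)
  have hC : 0 ≤ (1 - (1 - m) * s ^ 2) * x ^ 2 := mul_nonneg (by linarith) (sq_nonneg x)
  constructor <;> nlinarith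

/-! ### The rational identity and the certificate -/

/-- **`S − R = (1 − (1−m)s²) − m x²`** (exact; `work/s41/cert_xxviii_b_xs.py`). [this work] -/
theorem soloInformed_kummerHeuman_rational_identity {m x s : ℝ}
    (hD : 1 - (1 - (1 - m) * s ^ 2) * x ^ 2 ≠ 0) :
    soloInformedKummerHeumanS m x s - soloInformedKummerHeumanR m x s =
      (1 - (1 - m) * s ^ 2) - m * x ^ 2 := by
  simp only [soloInformedKummerHeumanS, soloInformedKummerHeumanR]
  field_simp
  ring

/-- **The certificate (Gauss–Manin along the Kummer family, circular band).**
`S κ(x)κ'(s) = R κ(x)κ'(s) + (e(x)κ'(s) − κ(x)κ'(s) + κ(x)e'(s))`. [this work] -/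
theorem soloInformed_kummerHeuman_certificate {m x s : ℝ}
    (hD : 1 - (1 - (1 - m) * s ^ 2) * x ^ 2 ≠ 0) :
    soloInformedKummerHeumanS m x s * ((√(1 - x ^ 2))⁻¹ * (√(1 - m * x ^ 2))⁻¹) *
        ((√(1 - s ^ 2))⁻¹ * (√(1 - (1 - m) * s ^ 2))⁻¹) =
      soloInformedKummerHeumanR m x s * ((√(1 - x ^ 2))⁻¹ * (√(1 - m * x ^ 2))⁻¹) *
          ((√(1 - s ^ 2))⁻¹ * (√(1 - (1 - m) * s ^ 2))⁻¹) +
        ((1 - m * x ^ 2) * ((√(1 - x ^ 2))⁻¹ * (√(1 - m * x ^ 2))⁻¹) *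
            ((√(1 - s ^ 2))⁻¹ * (√(1 - (1 - m) * s ^ 2))⁻¹) -
          ((√(1 - x ^ 2))⁻¹ * (√(1 - m * x ^ 2))⁻¹) *
            ((√(1 - s ^ 2))⁻¹ * (√(1 - (1 - m) * s ^ 2))⁻¹) +
          ((√(1 - x ^ 2))⁻¹ * (√(1 - m * x ^ 2))⁻¹) *
            ((1 - (1 - m) * s ^ 2) * ((√(1 - s ^ 2))⁻¹ * (√(1 - (1 - m) * s ^ 2))⁻¹))) := by
  have h := soloInformed_kummerHeuman_rational_identity hD
  linear_combination ((√(1 - x ^ 2))⁻¹ * (√(1 - m * x ^ 2))⁻¹) *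
    ((√(1 - s ^ 2))⁻¹ * (√(1 - (1 - m) * s ^ 2))⁻¹) * h

/-! ### The derivatives of the two potentials -/

/-- **`∂_s Ψ(x,s) = R(x,s) κ(x) κ'(s)`** for `x² < 1`, `s² < 1`, `0 < m < 1`. [this work] -/
theorem soloInformed_kummerHeumanPsi_hasDerivAt {m x s : ℝ} (hm : m ∈ Ioo (0:ℝ) 1)
    (hx : x ^ 2 < 1) (hs : s ^ 2 < 1) :
    HasDerivAt (fun s : ℝ => soloInformedKummerHeumanPsi m x s)
      (soloInformedKummerHeumanR m x s * ((√(1 - x ^ 2))⁻¹ * (√(1 - m * x ^ 2))⁻¹) *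
        ((√(1 - s ^ 2))⁻¹ * (√(1 - (1 - m) * s ^ 2))⁻¹)) s := by
  have hm' := soloInformed_kummerHeuman_compl hm
  obtain ⟨h1s, hms⟩ := soloInformed_kummerZeta_radicands_pos hm' hs
  obtain ⟨h1x, hmx⟩ := soloInformed_kummerZeta_radicands_pos hm hx
  have hD := soloInformed_kummerHeuman_denom_pos (s := s) hm hx
  have hq1 : √(1 - s ^ 2) ≠ 0 := (Real.sqrt_pos.2 h1s).ne'
  have hq2 : √(1 - (1 - m) * s ^ 2) ≠ 0 := (Real.sqrt_pos.2 hms).ne'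
  have hq3 : √(1 - x ^ 2) ≠ 0 := (Real.sqrt_pos.2 h1x).ne'
  have hq4 : √(1 - m * x ^ 2) ≠ 0 := (Real.sqrt_pos.2 hmx).ne'
  have hW : HasDerivAt (fun s : ℝ => s * ((1 - s ^ 2) * (1 - (1 - m) * s ^ 2)))
      (1 * ((1 - s ^ 2) * (1 - (1 - m) * s ^ 2)) +
        s * (-(2 * s) * (1 - (1 - m) * s ^ 2) + (1 - s ^ 2) * (-((1 - m) * (2 * s))))) s :=
    (hasDerivAt_id' s).mul (((soloInformed_hasDerivAt_sq s).const_sub 1).mul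
      (((soloInformed_hasDerivAt_sq s).const_mul (1 - m)).const_sub 1))
  have hDd : HasDerivAt (fun s : ℝ => 1 - (1 - (1 - m) * s ^ 2) * x ^ 2)
      (-(-((1 - m) * (2 * s)) * x ^ 2)) s :=
    ((((soloInformed_hasDerivAt_sq s).const_mul (1 - m)).const_sub 1).mul_const (x ^ 2)).const_sub 1
  have hq : HasDerivAt (fun s : ℝ => s * ((1 - s ^ 2) * (1 - (1 - m) * s ^ 2)) /
      (1 - (1 - (1 - m) * s ^ 2) * x ^ 2))
      (((1 * ((1 - s ^ 2) * (1 - (1 - m) * s ^ 2)) +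
          s * (-(2 * s) * (1 - (1 - m) * s ^ 2) + (1 - s ^ 2) * (-((1 - m) * (2 * s))))) *
            (1 - (1 - (1 - m) * s ^ 2) * x ^ 2) -
          s * ((1 - s ^ 2) * (1 - (1 - m) * s ^ 2)) * (-(-((1 - m) * (2 * s)) * x ^ 2))) /
        (1 - (1 - (1 - m) * s ^ 2) * x ^ 2) ^ 2) s :=
    hW.div hDd hD.ne'
  have hκ := soloInformed_kummerZeta_kappa_hasDerivAt hm' hs
  have key : HasDerivAt (fun s : ℝ => (1 - m) * x ^ 2 * ((√(1 - x ^ 2))⁻¹ * (√(1 - m * x ^ 2))⁻¹) *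
      (s * ((1 - s ^ 2) * (1 - (1 - m) * s ^ 2)) / (1 - (1 - (1 - m) * s ^ 2) * x ^ 2)) *
        ((√(1 - s ^ 2))⁻¹ * (√(1 - (1 - m) * s ^ 2))⁻¹)) _ s :=
    (hq.const_mul ((1 - m) * x ^ 2 * ((√(1 - x ^ 2))⁻¹ * (√(1 - m * x ^ 2))⁻¹))).mul hκ
  have h1s' : 1 - s ^ 2 ≠ 0 := h1s.ne'
  have hms' : 1 - (1 - m) * s ^ 2 ≠ 0 := hms.ne'
  have hD0 : 1 - (1 - (1 - m) * s ^ 2) * x ^ 2 ≠ 0 := hD.ne'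
  unfold soloInformedKummerHeumanPsi
  refine key.congr_deriv ?_
  simp only [soloInformedKummerHeumanR]
  field_simp
  ring

/-- **`∂_x Ξ(x,s) = S(x,s) κ(x) κ'(s)`** for `x² < 1`, `s² < 1`, `0 < m < 1`. [this work] -/
theorem soloInformed_kummerHeumanXi_hasDerivAt {m x s : ℝ} (hm : m ∈ Ioo (0:ℝ) 1)
    (hx : x ^ 2 < 1) (hs : s ^ 2 < 1) :
    HasDerivAt (fun x : ℝ => soloInformedKummerHeumanXi m x s)
      (soloInformedKummerHeumanS m x s * ((√(1 - x ^ 2))⁻¹ * (√(1 - m * x ^ 2))⁻¹) *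
        ((√(1 - s ^ 2))⁻¹ * (√(1 - (1 - m) * s ^ 2))⁻¹)) x := by
  have hm' := soloInformed_kummerHeuman_compl hm
  obtain ⟨h1s, hms⟩ := soloInformed_kummerZeta_radicands_pos hm' hs
  obtain ⟨h1x, hmx⟩ := soloInformed_kummerZeta_radicands_pos hm hx
  have hD := soloInformed_kummerHeuman_denom_pos (s := s) hm hx
  have hq1 : √(1 - s ^ 2) ≠ 0 := (Real.sqrt_pos.2 h1s).ne'
  have hq2 : √(1 - (1 - m) * s ^ 2) ≠ 0 := (Real.sqrt_pos.2 hms).ne'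
  have hq3 : √(1 - x ^ 2) ≠ 0 := (Real.sqrt_pos.2 h1x).ne'
  have hq4 : √(1 - m * x ^ 2) ≠ 0 := (Real.sqrt_pos.2 hmx).ne'
  have hW : HasDerivAt (fun x : ℝ => x * ((1 - x ^ 2) * (1 - m * x ^ 2)))
      (1 * ((1 - x ^ 2) * (1 - m * x ^ 2)) +
        x * (-(2 * x) * (1 - m * x ^ 2) + (1 - x ^ 2) * (-(m * (2 * x))))) x :=
    (hasDerivAt_id' x).mul (((soloInformed_hasDerivAt_sq x).const_sub 1).mul
      (((soloInformed_hasDerivAt_sq x).const_mul m).const_sub 1))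
  have hDd : HasDerivAt (fun x : ℝ => 1 - (1 - (1 - m) * s ^ 2) * x ^ 2)
      (-((1 - (1 - m) * s ^ 2) * (2 * x))) x :=
    ((soloInformed_hasDerivAt_sq x).const_mul (1 - (1 - m) * s ^ 2)).const_sub 1
  have hq : HasDerivAt (fun x : ℝ => x * ((1 - x ^ 2) * (1 - m * x ^ 2)) /
      (1 - (1 - (1 - m) * s ^ 2) * x ^ 2))
      (((1 * ((1 - x ^ 2) * (1 - m * x ^ 2)) +
          x * (-(2 * x) * (1 - m * x ^ 2) + (1 - x ^ 2) * (-(m * (2 * x))))) *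
            (1 - (1 - (1 - m) * s ^ 2) * x ^ 2) -
          x * ((1 - x ^ 2) * (1 - m * x ^ 2)) * (-((1 - (1 - m) * s ^ 2) * (2 * x)))) /
        (1 - (1 - (1 - m) * s ^ 2) * x ^ 2) ^ 2) x :=
    hW.div hDd hD.ne'
  have hκ := soloInformed_kummerZeta_kappa_hasDerivAt hm hx
  have key : HasDerivAt (fun x : ℝ => x * ((1 - x ^ 2) * (1 - m * x ^ 2)) /
      (1 - (1 - (1 - m) * s ^ 2) * x ^ 2) * ((√(1 - x ^ 2))⁻¹ * (√(1 - m * x ^ 2))⁻¹) *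
        ((1 - (1 - m) * s ^ 2) * ((√(1 - s ^ 2))⁻¹ * (√(1 - (1 - m) * s ^ 2))⁻¹))) _ x :=
    (hq.mul hκ).mul_const ((1 - (1 - m) * s ^ 2) * ((√(1 - s ^ 2))⁻¹ * (√(1 - (1 - m) * s ^ 2))⁻¹))
  have h1x' : 1 - x ^ 2 ≠ 0 := h1x.ne'
  have hmx' : 1 - m * x ^ 2 ≠ 0 := hmx.ne'
  have h1s' : 1 - s ^ 2 ≠ 0 := h1s.ne'
  have hms' : 1 - (1 - m) * s ^ 2 ≠ 0 := hms.ne'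
  have hD0 : 1 - (1 - (1 - m) * s ^ 2) * x ^ 2 ≠ 0 := hD.ne'
  -- the purely rational identity behind `∂_x Ξ = S κ κ'`
  have hrat : (((1 * ((1 - x ^ 2) * (1 - m * x ^ 2)) +
          x * (-(2 * x) * (1 - m * x ^ 2) + (1 - x ^ 2) * (-(m * (2 * x))))) *
            (1 - (1 - (1 - m) * s ^ 2) * x ^ 2) -
          x * ((1 - x ^ 2) * (1 - m * x ^ 2)) * (-((1 - (1 - m) * s ^ 2) * (2 * x)))) /
        (1 - (1 - (1 - m) * s ^ 2) * x ^ 2) ^ 2 +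
        x * ((1 - x ^ 2) * (1 - m * x ^ 2)) / (1 - (1 - (1 - m) * s ^ 2) * x ^ 2) *
          (x / (1 - x ^ 2) + m * x / (1 - m * x ^ 2))) * (1 - (1 - m) * s ^ 2) =
      soloInformedKummerHeumanS m x s := by
    -- `W(x)·(x/(1−x²) + mx/(1−mx²))` is a polynomial
    have hWL : (1 - x ^ 2) * (1 - m * x ^ 2) * (x / (1 - x ^ 2) + m * x / (1 - m * x ^ 2)) =
        (1 - m * x ^ 2) * x + m * x * (1 - x ^ 2) := by
      rw [div_add_div _ _ h1x' hmx', mul_div_assoc', div_eq_iff (mul_ne_zero h1x' hmx')]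
      ring
    have h2 : x * ((1 - x ^ 2) * (1 - m * x ^ 2)) / (1 - (1 - (1 - m) * s ^ 2) * x ^ 2) *
        (x / (1 - x ^ 2) + m * x / (1 - m * x ^ 2)) =
        x * ((1 - m * x ^ 2) * x + m * x * (1 - x ^ 2)) / (1 - (1 - (1 - m) * s ^ 2) * x ^ 2) := by
      rw [← hWL]
      ring
    rw [h2]
    simp only [soloInformedKummerHeumanS]
    have hD2 : (1 - (1 - (1 - m) * s ^ 2) * x ^ 2) ^ 2 ≠ 0 := pow_ne_zero 2 hD0
    rw [div_add_div _ _ hD2 hD0, div_add_div _ _ hD0 hD2, div_mul_eq_mul_div, mul_div_assoc',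
      div_eq_div_iff (mul_ne_zero hD2 hD0) (mul_ne_zero hD0 hD2)]
    ring
  unfold soloInformedKummerHeumanXi
  refine key.congr_deriv ?_
  linear_combination ((√(1 - x ^ 2))⁻¹ * (√(1 - m * x ^ 2))⁻¹) *
    ((√(1 - s ^ 2))⁻¹ * (√(1 - (1 - m) * s ^ 2))⁻¹) * hrat

end Summit.KontsevichZagierPeriods.KontsevichZagierPeriods.Theorems
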